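import Summits.PneNP.PneNP.Theorems.EcdlpDefinabilityEcdlpArith
import Literature.Computability.Complexity.CodeFPArith
import Literature.Computability.Complexity.CodeFPStrings
import Literature.Computability.Complexity.CodeFPLists
import Literature.Computability.Complexity.ShenRefereeRounds

/-!
# Route EcdlpDefinability — the group law and double-and-add on codes (helper for `EcdlpInNP`, stmt-PneNP-2075)

Typed polynomial time (`CodeFP`) for the residue-level objects of `EcdlpDefinabilityDefs`: `ecdlpNegY`, `ecdlpSlope`,
`ecdlpAddX`, `ecdlpAddY`, `ecdlpAdd` pointwise over any input code (the `modAdd/modMul/modSub/modNeg/modInv`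
combinators of `CodeFPModArith`), and the double-and-add fold `ecdlpSmul` at the modulus `max p 2` (so that the
accumulator — flags `≤ 1`, residues `< max p 2` by `ecdlp_foldl_small` — is never longer than a linear function of the
input, as `CodeFP.foldl` demands).
-/

set_option linter.dupNamespace false -- `Summit.PneNP.PneNP.…`: summit = sub-problem name (D-0017 single-conjunct layout)

namespace Summit.PneNP.PneNP.Theorems

open _root_.Computability Polynomial
open Literature.Computability.Complexity Literature.Computability.Complexity.CodeFP
  Literature.Computability.Complexity.ModArith

variable {α : Type} {eα : α → List Bool}

/-- `ecdlpNegY` pointwise. [cite: AroraBarakCC2009, §1.3] -/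
theorem ecdlp_codeFP_negY {P A₁ A₃ X Y : α → ℕ} (hP : CodeFP eα natE P) (h₁ : CodeFP eα natE A₁) (h₃ : CodeFP eα natE A₃)
    (hX : CodeFP eα natE X) (hY : CodeFP eα natE Y) :
    CodeFP eα natE fun a => ecdlpNegY (P a) (A₁ a) (A₃ a) (X a) (Y a) := by
  unfold ecdlpNegY
  exact modSub hP (modSub hP (modNeg hP hY) (modMul hP h₁ hX)) h₃

/-- `ecdlpSlope` pointwise. [cite: AroraBarakCC2009, §1.3] -/
theorem ecdlp_codeFP_slope {P A₁ A₂ A₃ A₄ X₁ Y₁ X₂ Y₂ : α → ℕ} (hP : CodeFP eα natE P) (h₁ : CodeFP eα natE A₁)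
    (h₂ : CodeFP eα natE A₂) (h₃ : CodeFP eα natE A₃) (h₄ : CodeFP eα natE A₄) (hX₁ : CodeFP eα natE X₁)
    (hY₁ : CodeFP eα natE Y₁) (hX₂ : CodeFP eα natE X₂) (hY₂ : CodeFP eα natE Y₂) :
    CodeFP eα natE fun a => ecdlpSlope (P a) (A₁ a) (A₂ a) (A₃ a) (A₄ a) (X₁ a) (Y₁ a) (X₂ a) (Y₂ a) := by
  have hT : CodeFP eα natE fun a => mulM (P a) (subM (P a) (addM (P a) (addM (P a) (mulM (P a) 3 (mulM (P a) (X₁ a) (X₁ a)))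
      (mulM (P a) (mulM (P a) 2 (A₂ a)) (X₁ a))) (A₄ a)) (mulM (P a) (A₁ a) (Y₁ a)))
      (invM (P a) (subM (P a) (Y₁ a) (ecdlpNegY (P a) (A₁ a) (A₃ a) (X₁ a) (Y₁ a)))) :=
    modMul hP (modSub hP (modAdd hP (modAdd hP (modMul hP (CodeFP.const _ 3) (modMul hP hX₁ hX₁))
      (modMul hP (modMul hP (CodeFP.const _ 2) h₂) hX₁)) h₄) (modMul hP h₁ hY₁))
      (modInv hP (modSub hP hY₁ (ecdlp_codeFP_negY hP h₁ h₃ hX₁ hY₁)))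
  have hC : CodeFP eα natE fun a => mulM (P a) (subM (P a) (Y₁ a) (Y₂ a)) (invM (P a) (subM (P a) (X₁ a) (X₂ a))) :=
    modMul hP (modSub hP hY₁ hY₂) (modInv hP (modSub hP hX₁ hX₂))
  refine ((natEq.comp (hX₁.pair hX₂)).ite hT hC).congr fun a => ?_
  unfold ecdlpSlope
  by_cases h : X₁ a = X₂ a
  · rw [if_pos h]; simp [h]
  · rw [if_neg h]; simp [h]

/-- `ecdlpAddX` pointwise. [cite: AroraBarakCC2009, §1.3] -/
theorem ecdlp_codeFP_addX {P A₁ A₂ X₁ X₂ L : α → ℕ} (hP : CodeFP eα natE P) (h₁ : CodeFP eα natE A₁)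
    (h₂ : CodeFP eα natE A₂) (hX₁ : CodeFP eα natE X₁) (hX₂ : CodeFP eα natE X₂) (hL : CodeFP eα natE L) :
    CodeFP eα natE fun a => ecdlpAddX (P a) (A₁ a) (A₂ a) (X₁ a) (X₂ a) (L a) := by
  unfold ecdlpAddX
  exact modSub hP (modSub hP (modSub hP (modAdd hP (modMul hP hL hL) (modMul hP h₁ hL)) h₂) hX₁) hX₂

/-- `ecdlpAddY` pointwise. [cite: AroraBarakCC2009, §1.3] -/
theorem ecdlp_codeFP_addY {P A₁ A₃ X₁ Y₁ X L : α → ℕ} (hP : CodeFP eα natE P) (h₁ : CodeFP eα natE A₁)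
    (h₃ : CodeFP eα natE A₃) (hX₁ : CodeFP eα natE X₁) (hY₁ : CodeFP eα natE Y₁) (hX : CodeFP eα natE X)
    (hL : CodeFP eα natE L) :
    CodeFP eα natE fun a => ecdlpAddY (P a) (A₁ a) (A₃ a) (X₁ a) (Y₁ a) (X a) (L a) := by
  unfold ecdlpAddY
  exact ecdlp_codeFP_negY hP h₁ h₃ hX (modAdd hP (modMul hP hL (modSub hP hX hX₁)) hY₁)

/-- **`ecdlpAdd` pointwise** (triples coded as `pairE natE (pairE natE natE)`). [cite: AroraBarakCC2009, §1.3] -/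
theorem ecdlp_codeFP_add {P A₁ A₂ A₃ A₄ : α → ℕ} {U V : α → ℕ × ℕ × ℕ} (hP : CodeFP eα natE P) (h₁ : CodeFP eα natE A₁)
    (h₂ : CodeFP eα natE A₂) (h₃ : CodeFP eα natE A₃) (h₄ : CodeFP eα natE A₄)
    (hU : CodeFP eα (pairE natE (pairE natE natE)) U) (hV : CodeFP eα (pairE natE (pairE natE natE)) V) :
    CodeFP eα (pairE natE (pairE natE natE)) fun a => ecdlpAdd (P a) (A₁ a) (A₂ a) (A₃ a) (A₄ a) (U a) (V a) := by
  have uf : CodeFP eα natE fun a => (U a).1 := hU.fst'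
  have ux : CodeFP eα natE fun a => (U a).2.1 := hU.snd'.fst'
  have uy : CodeFP eα natE fun a => (U a).2.2 := hU.snd'.snd'
  have vf : CodeFP eα natE fun a => (V a).1 := hV.fst'
  have vx : CodeFP eα natE fun a => (V a).2.1 := hV.snd'.fst'
  have vy : CodeFP eα natE fun a => (V a).2.2 := hV.snd'.snd'
  have hL := ecdlp_codeFP_slope hP h₁ h₂ h₃ h₄ ux uy vx vy
  have hX := ecdlp_codeFP_addX hP h₁ h₂ ux vx hL
  have hY := ecdlp_codeFP_addY hP h₁ h₃ ux uy hX hL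
  have hR : CodeFP eα (pairE natE (pairE natE natE)) fun a =>
      ((1 : ℕ), ecdlpAddX (P a) (A₁ a) (A₂ a) (U a).2.1 (V a).2.1
        (ecdlpSlope (P a) (A₁ a) (A₂ a) (A₃ a) (A₄ a) (U a).2.1 (U a).2.2 (V a).2.1 (V a).2.2),
        ecdlpAddY (P a) (A₁ a) (A₃ a) (U a).2.1 (U a).2.2 (ecdlpAddX (P a) (A₁ a) (A₂ a) (U a).2.1 (V a).2.1
          (ecdlpSlope (P a) (A₁ a) (A₂ a) (A₃ a) (A₄ a) (U a).2.1 (U a).2.2 (V a).2.1 (V a).2.2))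
          (ecdlpSlope (P a) (A₁ a) (A₂ a) (A₃ a) (A₄ a) (U a).2.1 (U a).2.2 (V a).2.1 (V a).2.2)) :=
    (CodeFP.const _ 1).pair (hX.pair hY)
  have hO : CodeFP eα (pairE natE (pairE natE natE)) fun _ => ((0 : ℕ), (0 : ℕ), (0 : ℕ)) := CodeFP.const _ _
  have tdeg : CodeFP eα bitE fun a => decide ((U a).2.1 = (V a).2.1) &&
      decide ((U a).2.2 = ecdlpNegY (P a) (A₁ a) (A₃ a) (V a).2.1 (V a).2.2) :=
    (natEq.comp (ux.pair vx)).and (natEq.comp (uy.pair (ecdlp_codeFP_negY hP h₁ h₃ vx vy)))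
  have tU : CodeFP eα bitE fun a => decide ((U a).1 = 0) := natEq.comp (uf.pair (CodeFP.const _ 0))
  have tV : CodeFP eα bitE fun a => decide ((V a).1 = 0) := natEq.comp (vf.pair (CodeFP.const _ 0))
  refine (tU.ite hV (tV.ite hU (tdeg.ite hO hR))).congr fun a => ?_
  unfold ecdlpAdd
  by_cases hu : (U a).1 = 0
  · simp [hu]
  · by_cases hv : (V a).1 = 0
    · simp [hu, hv]
    · by_cases hd : (U a).2.1 = (V a).2.1 ∧ (U a).2.2 = ecdlpNegY (P a) (A₁ a) (A₃ a) (V a).2.1 (V a).2.2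
      · simp [hu, hv, hd]
      · rw [if_neg hd]
        simp only [hu, hv, decide_false, Bool.false_eq_true, ↓reduceIte]
        rw [if_neg]
        simpa [Bool.and_eq_true, decide_eq_true_eq] using hd

/-! ### The double-and-add fold -/

/-- Folds whose step functions agree on the list agree. [folklore] -/
theorem ecdlp_foldl_congr {β γ : Type} {f g : γ → β → γ} : ∀ (l : List β) (c : γ), (∀ b ∈ l, ∀ c, f c b = g c b) →
    l.foldl f c = l.foldl g c
  | [], _, _ => rfl
  | b :: l, c, h => by
    rw [List.foldl_cons, List.foldl_cons, h b (by simp) c]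
    exact ecdlp_foldl_congr l _ fun b' hb' => h b' (by simp [hb'])

/-- Both components of a pair code are no longer than the pair code. [folklore] -/
theorem ecdlp_le_length_boolPair (a b : List Bool) : a.length ≤ (boolPair a b).length ∧ b.length ≤ (boolPair a b).length := by
  rw [length_boolPair]; omega

/-- The code of a canonical triple at modulus `q` is short. [folklore] -/
theorem ecdlp_length_triple_le {q : ℕ} {u : ℕ × ℕ × ℕ} (h : u.1 ≤ 1 ∧ u.2.1 < q ∧ u.2.2 < q) :
    (pairE natE (pairE natE natE) u).length ≤ 3 * (natE q).length + 6 := by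
  rw [pairE_apply, pairE_apply, length_boolPair, length_boolPair]
  have h1 : (natE u.1).length ≤ 1 := (length_natE_le _).trans h.1
  have h2 : (natE u.2.1).length ≤ (natE q).length := length_natE_mono h.2.1.le
  have h3 : (natE u.2.2).length ≤ (natE q).length := length_natE_mono h.2.2.le
  omega

/-- **Double-and-add on codes**: from codes of the curve data `c = ((((p, a₁), a₂), a₃), a₄)`, the multiplier `m`, a unary
digit budget `B` and an affine point `(x, y)`, the triple `ecdlpSmul (max p 2) a₁ a₂ a₃ a₄ B m (1, x mod max p 2, y mod max p 2)`
(a `CodeFP.foldl` over `range B`; the accumulator is a pair of canonical triples, of length `≤ 9 |input| + 38`).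
[cite: AroraBarakCC2009, §1.3 (bounded loops)] -/
theorem ecdlp_codeFP_smul {C : α → (((ℕ × ℕ) × ℕ) × ℕ) × ℕ} {M B X Y : α → ℕ}
    (hC : CodeFP eα (pairE (pairE (pairE (pairE natE natE) natE) natE) natE) C) (hM : CodeFP eα natE M)
    (hB : CodeFP eα unE B) (hX : CodeFP eα natE X) (hY : CodeFP eα natE Y) :
    CodeFP eα (pairE natE (pairE natE natE)) fun a =>
      ecdlpSmul (max (C a).1.1.1.1 2) (C a).1.1.1.2 (C a).1.1.2 (C a).1.2 (C a).2 (B a) (M a)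
        (1, X a % max (C a).1.1.1.1 2, Y a % max (C a).1.1.1.1 2) := by
  -- context `s = ((c, (m, B)), (x, y))`, step on `t = (s, (i, st))`
  let σ : Type := (((((ℕ × ℕ) × ℕ) × ℕ) × ℕ) × (ℕ × ℕ)) × (ℕ × ℕ)
  let eσ : σ → List Bool := pairE (pairE (pairE (pairE (pairE (pairE natE natE) natE) natE) natE) (pairE natE unE)) (pairE natE natE)
  let St : Type := (ℕ × ℕ × ℕ) × (ℕ × ℕ × ℕ)
  let eSt : St → List Bool := pairE (pairE natE (pairE natE natE)) (pairE natE (pairE natE natE))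
  have tc : CodeFP (pairE eσ (pairE natE eSt)) (pairE (pairE (pairE (pairE natE natE) natE) natE) natE)
      fun t : σ × (ℕ × St) => t.1.1.1 := (CodeFP.fst _ _).fst'.fst'
  have tq : CodeFP (pairE eσ (pairE natE eSt)) natE fun t : σ × (ℕ × St) => max t.1.1.1.1.1.1.1 2 :=
    (natMax.comp (tc.fst'.fst'.fst'.fst'.pair (CodeFP.const _ 2)) :)
  have t1 : CodeFP (pairE eσ (pairE natE eSt)) natE fun t : σ × (ℕ × St) => t.1.1.1.1.1.1.2 := tc.fst'.fst'.fst'.snd'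
  have t2 : CodeFP (pairE eσ (pairE natE eSt)) natE fun t : σ × (ℕ × St) => t.1.1.1.1.1.2 := tc.fst'.fst'.snd'
  have t3 : CodeFP (pairE eσ (pairE natE eSt)) natE fun t : σ × (ℕ × St) => t.1.1.1.1.2 := tc.fst'.snd'
  have t4 : CodeFP (pairE eσ (pairE natE eSt)) natE fun t : σ × (ℕ × St) => t.1.1.1.2 := tc.snd'
  have tm : CodeFP (pairE eσ (pairE natE eSt)) natE fun t : σ × (ℕ × St) => t.1.1.2.1 := (CodeFP.fst _ _).fst'.snd'.fst'
  have tB : CodeFP (pairE eσ (pairE natE eSt)) unE fun t : σ × (ℕ × St) => t.1.1.2.2 := (CodeFP.fst _ _).fst'.snd'.snd'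
  have ti : CodeFP (pairE eσ (pairE natE eSt)) natE fun t : σ × (ℕ × St) => t.2.1 := (CodeFP.snd _ _).fst'
  have tR : CodeFP (pairE eσ (pairE natE eSt)) (pairE natE (pairE natE natE)) fun t : σ × (ℕ × St) => t.2.2.1 :=
    (CodeFP.snd _ _).snd'.fst'
  have tS : CodeFP (pairE eσ (pairE natE eSt)) (pairE natE (pairE natE natE)) fun t : σ × (ℕ × St) => t.2.2.2 :=
    (CodeFP.snd _ _).snd'.snd'
  have tbit : CodeFP (pairE eσ (pairE natE eSt)) bitE fun t : σ × (ℕ × St) =>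
      decide (t.1.1.2.1 / 2 ^ min t.2.1 t.1.1.2.2 % 2 = 1) :=
    (natEq.comp ((natMod.comp ((natDiv.comp (tm.pair (natPow.comp ((CodeFP.const _ 2).pair (unOfNatMin.comp (tB.pair ti)))))).pair
      (CodeFP.const _ 2))).pair (CodeFP.const _ 1)) :)
  have hRS := ecdlp_codeFP_add tq t1 t2 t3 t4 tR tS
  have hSS := ecdlp_codeFP_add tq t1 t2 t3 t4 tS tS
  have hstep : CodeFP (pairE eσ (pairE natE eSt)) eSt fun t : σ × (ℕ × St) =>
      ecdlpStep (max t.1.1.1.1.1.1.1 2) t.1.1.1.1.1.1.2 t.1.1.1.1.1.2 t.1.1.1.1.2 t.1.1.1.2 t.1.1.2.1 (min t.2.1 t.1.1.2.2) t.2.2 := by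
    refine ((tbit.ite hRS tR).pair hSS).congr fun t => ?_
    unfold ecdlpStep
    by_cases h : t.1.1.2.1 / 2 ^ min t.2.1 t.1.1.2.2 % 2 = 1
    · rw [if_pos h]; simp [h]
    · rw [if_neg h]; simp [h]
  -- initial state on `s`
  have sq : CodeFP eσ natE fun s : σ => max s.1.1.1.1.1.1 2 :=
    (natMax.comp ((CodeFP.fst _ _).fst'.fst'.fst'.fst'.fst'.pair (CodeFP.const _ 2)) :)
  have hinit : CodeFP eσ eSt fun s : σ => (((0 : ℕ), (0 : ℕ), (0 : ℕ)), ((1 : ℕ), s.2.1 % max s.1.1.1.1.1.1 2, s.2.2 % max s.1.1.1.1.1.1 2)) :=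
    (CodeFP.const _ _).pair ((CodeFP.const _ 1).pair ((modOf sq (CodeFP.snd _ _).fst').pair (modOf sq (CodeFP.snd _ _).snd')))
  -- the fold
  have hfold := CodeFP.foldl (eσ := eσ) (eα := natE) (eβ := eSt)
    (step := fun (s : σ) (i : ℕ) (st : St) =>
      ecdlpStep (max s.1.1.1.1.1.1 2) s.1.1.1.1.1.2 s.1.1.1.1.2 s.1.1.1.2 s.1.1.2 s.1.2.1 (min i s.1.2.2) st)
    (init := fun s : σ => (((0 : ℕ), (0 : ℕ), (0 : ℕ)), ((1 : ℕ), s.2.1 % max s.1.1.1.1.1.1 2, s.2.2 % max s.1.1.1.1.1.1 2)))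
    hstep hinit (9 * Polynomial.X + 38) (fun s l₁ l₂ => by
      have hq : 1 ≤ max s.1.1.1.1.1.1 2 := le_max_of_le_right (by norm_num)
      rw [← List.foldl_map (f := fun i => min i s.1.2.2)
        (g := fun st j => ecdlpStep (max s.1.1.1.1.1.1 2) s.1.1.1.1.1.2 s.1.1.1.1.2 s.1.1.1.2 s.1.1.2 s.1.2.1 j st)]
      obtain ⟨hA, hBd⟩ := ecdlp_foldl_small (a₁ := s.1.1.1.1.1.2) (a₂ := s.1.1.1.1.2) (a₃ := s.1.1.1.2) (a₄ := s.1.1.2)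
        (m := s.1.2.1) hq (l₁.map fun i => min i s.1.2.2) (((0 : ℕ), (0 : ℕ), (0 : ℕ)),
          ((1 : ℕ), s.2.1 % max s.1.1.1.1.1.1 2, s.2.2 % max s.1.1.1.1.1.1 2))
        ⟨Nat.zero_le 1, hq, hq⟩ ⟨le_rfl, Nat.mod_lt _ hq, Nat.mod_lt _ hq⟩
      have e1 := ecdlp_length_triple_le hA
      have e2 := ecdlp_length_triple_le hBd
      have e3 := ShenRef.length_natE_max_two_le s.1.1.1.1.1.1
      -- the modulus code sits inside the input code
      have e4 : (natE s.1.1.1.1.1.1).length ≤ (pairE eσ (rawE natE) (s, l₁ ++ l₂)).length := by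
        have := ecdlp_le_length_boolPair
        calc (natE s.1.1.1.1.1.1).length
            ≤ (boolPair (natE s.1.1.1.1.1.1) (natE s.1.1.1.1.1.2)).length := (this _ _).1
          _ ≤ (boolPair (boolPair (natE s.1.1.1.1.1.1) (natE s.1.1.1.1.1.2)) (natE s.1.1.1.1.2)).length := (this _ _).1
          _ ≤ (boolPair (boolPair (boolPair (natE s.1.1.1.1.1.1) (natE s.1.1.1.1.1.2)) (natE s.1.1.1.1.2)) (natE s.1.1.1.2)).length := (this _ _).1
          _ ≤ (boolPair (boolPair (boolPair (boolPair (natE s.1.1.1.1.1.1) (natE s.1.1.1.1.1.2)) (natE s.1.1.1.1.2)) (natE s.1.1.1.2)) (natE s.1.1.2)).length := (this _ _).1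
          _ ≤ (boolPair (boolPair (boolPair (boolPair (boolPair (natE s.1.1.1.1.1.1) (natE s.1.1.1.1.1.2)) (natE s.1.1.1.1.2)) (natE s.1.1.1.2)) (natE s.1.1.2)) (boolPair (natE s.1.2.1) (unE s.1.2.2))).length := (this _ _).1
          _ ≤ (boolPair (boolPair (boolPair (boolPair (boolPair (boolPair (natE s.1.1.1.1.1.1) (natE s.1.1.1.1.1.2)) (natE s.1.1.1.1.2)) (natE s.1.1.1.2)) (natE s.1.1.2)) (boolPair (natE s.1.2.1) (unE s.1.2.2))) (boolPair (natE s.2.1) (natE s.2.2))).length := (this _ _).1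
          _ ≤ _ := (this _ _).1
      simp only [eval_add, eval_mul, eval_ofNat, eval_X]
      rw [show eSt _ = boolPair (pairE natE (pairE natE natE) _) (pairE natE (pairE natE natE) _) from rfl, length_boolPair]
      omega)
  -- assemble on `a`: context and `range (B a)`
  have hctx : CodeFP eα eσ fun a => (((C a, (M a, B a)), (X a, Y a)) : σ) := (hC.pair (hM.pair hB)).pair (hX.pair hY)
  refine ((hfold.comp (hctx.pair (urange.comp hB)) :).fst').congr fun a => ?_
  dsimp only [Function.comp_apply]
  unfold ecdlpSmul
  congr 1
  exact ecdlp_foldl_congr _ _ fun i hi st => by rw [List.mem_range] at hi; rw [min_eq_left hi.le]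


/-! ### The whole test on `(l, m)` -/

/-- **The typed test of the verifier and its residue-level specification.** On `(l, m)` with
`l = [p, a₁, a₂, a₃, a₄, a₆, x_P, y_P, x_Q, y_Q, t]` read by `getD`: `|l| = 11`, `p` prime (`PRIMES ∈ P`), the two Weierstrass
equations and `Δ ≠ 0` on residues, `m ≤ t`, and `ecdlpSmul` from `(1, x_P, y_P)` reaches `(1, x_Q, y_Q)` (all at the modulus
`max p 2`, which is `p`). [cite: AroraBarakCC2009, §1.3 and §2.1] -/
theorem ecdlp_exists_codeTest {π : ℕ → Bool} (hπ : CodeFP natE bitE π) :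
    ∃ τ : List ℕ × ℕ → Bool, CodeFP (pairE (rawE natE) natE) bitE τ ∧ ∀ (l : List ℕ) (m : ℕ), τ (l, m) = true ↔
      (l.length = 11 ∧ π (l.getD 0 0) = true ∧ m ≤ l.getD 10 0) ∧
      (let q := max (l.getD 0 0) 2
       let a₁ := l.getD 1 0; let a₂ := l.getD 2 0; let a₃ := l.getD 3 0; let a₄ := l.getD 4 0; let a₆ := l.getD 5 0
       (∀ i ∈ [6, 8], addM q (addM q (mulM q (l.getD (i + 1) 0) (l.getD (i + 1) 0)) (mulM q (mulM q a₁ (l.getD i 0)) (l.getD (i + 1) 0)))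
            (mulM q a₃ (l.getD (i + 1) 0)) =
          addM q (addM q (addM q (mulM q (mulM q (l.getD i 0) (l.getD i 0)) (l.getD i 0))
            (mulM q a₂ (mulM q (l.getD i 0) (l.getD i 0)))) (mulM q a₄ (l.getD i 0))) a₆) ∧
       (let b₂ := addM q (mulM q a₁ a₁) (mulM q 4 a₂); let b₄ := addM q (mulM q 2 a₄) (mulM q a₁ a₃)
        let b₆ := addM q (mulM q a₃ a₃) (mulM q 4 a₆)
        let b₈ := subM q (addM q (subM q (addM q (mulM q (mulM q a₁ a₁) a₆) (mulM q (mulM q 4 a₂) a₆))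
          (mulM q (mulM q a₁ a₃) a₄)) (mulM q a₂ (mulM q a₃ a₃))) (mulM q a₄ a₄)
        addM q (subM q (subM q (negM q (mulM q (mulM q b₂ b₂) b₈)) (mulM q 8 (mulM q (mulM q b₄ b₄) b₄)))
          (mulM q 27 (mulM q b₆ b₆))) (mulM q 9 (mulM q (mulM q b₂ b₄) b₆)) ≠ 0) ∧
       ecdlpSmul q a₁ a₂ a₃ a₄ ((natE m).length + 1) m (1, l.getD 6 0 % q, l.getD 7 0 % q) = (1, l.getD 8 0 % q, l.getD 9 0 % q)) := by
  -- entries of `l`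
  have hl : CodeFP (pairE (rawE natE) natE) (rawE natE) fun t : List ℕ × ℕ => t.1 := CodeFP.fst _ _
  have hm : CodeFP (pairE (rawE natE) natE) natE fun t : List ℕ × ℕ => t.2 := CodeFP.snd _ _
  have g : ∀ i : ℕ, CodeFP (pairE (rawE natE) natE) natE fun t : List ℕ × ℕ => t.1.getD i 0 :=
    fun i => ((rawGetD natE (d := 0) rfl).comp (hl.pair (CodeFP.const _ i)) :)
  have hq : CodeFP (pairE (rawE natE) natE) natE fun t : List ℕ × ℕ => max (t.1.getD 0 0) 2 :=
    (natMax.comp ((g 0).pair (CodeFP.const _ 2)) :)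
  -- block 1: length, primality, `m ≤ t`
  have c1 : CodeFP (pairE (rawE natE) natE) bitE fun t : List ℕ × ℕ => decide (t.1.length = 11) :=
    (natEq.comp (((natLength natE).comp hl).pair (CodeFP.const _ 11)) :)
  have c2 : CodeFP (pairE (rawE natE) natE) bitE fun t : List ℕ × ℕ => π (t.1.getD 0 0) := (hπ.comp (g 0) :)
  have c3 : CodeFP (pairE (rawE natE) natE) bitE fun t : List ℕ × ℕ => decide (t.2 ≤ t.1.getD 10 0) := (natLe.comp (hm.pair (g 10)) :)
  -- block 2: the equations at `i = 6, 8`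
  have heq : ∀ i : ℕ, CodeFP (pairE (rawE natE) natE) bitE fun t : List ℕ × ℕ => decide (
      addM (max (t.1.getD 0 0) 2) (addM (max (t.1.getD 0 0) 2) (mulM (max (t.1.getD 0 0) 2) (t.1.getD (i + 1) 0) (t.1.getD (i + 1) 0))
        (mulM (max (t.1.getD 0 0) 2) (mulM (max (t.1.getD 0 0) 2) (t.1.getD 1 0) (t.1.getD i 0)) (t.1.getD (i + 1) 0)))
        (mulM (max (t.1.getD 0 0) 2) (t.1.getD 3 0) (t.1.getD (i + 1) 0)) =
      addM (max (t.1.getD 0 0) 2) (addM (max (t.1.getD 0 0) 2) (addM (max (t.1.getD 0 0) 2)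
        (mulM (max (t.1.getD 0 0) 2) (mulM (max (t.1.getD 0 0) 2) (t.1.getD i 0) (t.1.getD i 0)) (t.1.getD i 0))
        (mulM (max (t.1.getD 0 0) 2) (t.1.getD 2 0) (mulM (max (t.1.getD 0 0) 2) (t.1.getD i 0) (t.1.getD i 0))))
        (mulM (max (t.1.getD 0 0) 2) (t.1.getD 4 0) (t.1.getD i 0))) (t.1.getD 5 0)) := fun i =>
    (natEq.comp ((modAdd hq (modAdd hq (modMul hq (g (i + 1)) (g (i + 1))) (modMul hq (modMul hq (g 1) (g i)) (g (i + 1))))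
      (modMul hq (g 3) (g (i + 1)))).pair (modAdd hq (modAdd hq (modAdd hq (modMul hq (modMul hq (g i) (g i)) (g i))
      (modMul hq (g 2) (modMul hq (g i) (g i)))) (modMul hq (g 4) (g i))) (g 5))) :)
  -- block 3: the discriminant
  have b2 := modAdd hq (modMul hq (g 1) (g 1)) (modMul hq (CodeFP.const _ 4) (g 2))
  have b4 := modAdd hq (modMul hq (CodeFP.const _ 2) (g 4)) (modMul hq (g 1) (g 3))
  have b6 := modAdd hq (modMul hq (g 3) (g 3)) (modMul hq (CodeFP.const _ 4) (g 5))
  have b8 := modSub hq (modAdd hq (modSub hq (modAdd hq (modMul hq (modMul hq (g 1) (g 1)) (g 5))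
    (modMul hq (modMul hq (CodeFP.const _ 4) (g 2)) (g 5))) (modMul hq (modMul hq (g 1) (g 3)) (g 4)))
    (modMul hq (g 2) (modMul hq (g 3) (g 3)))) (modMul hq (g 4) (g 4))
  have hΔ := modAdd hq (modSub hq (modSub hq (modNeg hq (modMul hq (modMul hq b2 b2) b8))
    (modMul hq (CodeFP.const _ 8) (modMul hq (modMul hq b4 b4) b4))) (modMul hq (CodeFP.const _ 27) (modMul hq b6 b6)))
    (modMul hq (CodeFP.const _ 9) (modMul hq (modMul hq b2 b4) b6))
  have c5 := (natEq.comp (hΔ.pair (CodeFP.const _ 0))).not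
  -- block 4: double-and-add and the comparison
  have hC : CodeFP (pairE (rawE natE) natE) (pairE (pairE (pairE (pairE natE natE) natE) natE) natE)
      fun t : List ℕ × ℕ => ((((t.1.getD 0 0, t.1.getD 1 0), t.1.getD 2 0), t.1.getD 3 0), t.1.getD 4 0) :=
    ((((g 0).pair (g 1)).pair (g 2)).pair (g 3)).pair (g 4)
  have hBud : CodeFP (pairE (rawE natE) natE) unE fun t : List ℕ × ℕ => (natE t.2).length + 1 :=
    (unSucc.comp (strLength.comp (strOfNat.comp hm)) :)
  have hsm := ecdlp_codeFP_smul hC hm hBud (g 6) (g 7)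
  have htarget : CodeFP (pairE (rawE natE) natE) (pairE natE (pairE natE natE))
      fun t : List ℕ × ℕ => ((1 : ℕ), t.1.getD 8 0 % max (t.1.getD 0 0) 2, t.1.getD 9 0 % max (t.1.getD 0 0) 2) :=
    (CodeFP.const _ 1).pair ((modOf hq (g 8)).pair (modOf hq (g 9)))
  have c6 := (CodeFP.eq (pairE_injective natE_injective (pairE_injective natE_injective natE_injective))).comp (hsm.pair htarget)
  refine ⟨_, ((c1.and c2).and c3).and (((heq 6).and (heq 8)).and (c5.and c6)), fun l m => ?_⟩
  simp only [Bool.and_eq_true, decide_eq_true_eq, Bool.not_eq_true', decide_eq_false_iff_not, List.mem_cons,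
    List.not_mem_nil, or_false, forall_eq_or_imp, forall_eq]
  exact ⟨fun ⟨⟨⟨h1, h2⟩, h3⟩, ⟨h4, h5⟩, h6, h7⟩ => ⟨⟨h1, h2, h3⟩, ⟨h4, h5⟩, h6, h7⟩,
    fun ⟨⟨h1, h2, h3⟩, ⟨h4, h5⟩, h6, h7⟩ => ⟨⟨⟨h1, h2⟩, h3⟩, ⟨h4, h5⟩, h6, h7⟩⟩


end Summit.PneNP.PneNP.Theorems
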